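import Mathlib
import Literature.MathematicalPhysics.QuantumFieldTheory.Balaban1983to89.B14InterpolationMeasure

/-!
# `Balaban1983to89.B14InterpolationMgf` — [Balaban1988Convergent] (3.27) p. 271: the tilted expectation `⟨·⟩_{s,t}` and
the normalization `Z_{s,t}` of the LINEAR interpolations ARE Mathlib's exponentially tilted measure / moment generating
function; consequently `log Z_t` is ANALYTIC in the parameter (all `t`-derivatives exist — the expansions "up to the
second order" of p. 273 are derivatives of an analytic function)

statement-level skeleton of published theorems with citation tags; proofs where landed; nothing here is a
claim about the Yang–Mills mass gap

PDF held: `paper:balaban1988-cmp119-convergent-renormalization` (journal page = PDF page + 242; (3.27) read on the x2 render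
p029 of `run/shared/lean/pub/pub-balaban/b2b-balaban-ref1/pages/1988-cmp119-convergent-renormalization/`).

CITATION HEADER (lean-in-tree rule).  Source: T. Bałaban, *Convergent renormalization expansions for lattice gauge
theories*, Commun. Math. Phys. **119**, 243–285 (1988), doi:10.1007/bf01217741 [Balaban1988Convergent] (cell paper B14).
Mega-formalization `lit-balaban` (HOME `run/shared/lean/pub/lit-balaban/`), Phase-2 proof seat p27, generation 2 (unit
`lit-balaban-p27`); third file of the (3.26)–(3.27) group after `B14InterpolationMeasure` (p243938) and `B14Eq326Measure`.
WHAT IS REPRODUCED: SKELETON row **B14.Eq3.27** (the probabilistic measure `Z_{s,t}⁻¹ dμ χ_k exp[… + t(·)]` and its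
expectation), in Mathlib's vocabulary.

THE PRINTED TEXT (verbatim, p. 271 [PDF 29]).  *"Here ⟨·⟩_{s,t} denotes the expectation value with respect to the
probabilistic measure Z_{s,t}^{−1} dμ_{C^{(k)}(Λ_{k+1})}(A) χ_k exp[−⟨A, C*Δ^{(k)}CA_k⟩ + 𝐏^{(k)} + {….}_{s,t} + tV^{(k)}(S_k)], (3.27)
where the introduction of the parameters s, t was described above, and Z_{s,t} is the normalization factor."*  And p. 273:
*"These we expand up to the second order with respect to tg_kCA … the differentiation with respect to tg_k yields such
an inner product."*

WHAT IS TYPED AND PROVED (arbitrary measure space `(Ω, ν)`, reference weight `w` integrable and `≥ 0` a.e. — the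
un-parametrised density `χ_k exp[…]` — and a bounded measurable `Y` multiplied by the parameter `t`).
* `refMeasure ν w = w·ν` (Mathlib `withDensity`), finite (`isFiniteMeasure_refMeasure`), `integral_refMeasure`.
* `partFn_linear_eq_mgf`: `Z_t = ∫ w e^{tY} dν = ProbabilityTheory.mgf Y (w·ν) t`; `log_partFn_linear_eq_cgf`.
* `gibbsExpect_linear_eq_integral_tilted`: `⟨G⟩_t = ∫ G d((w·ν).tilted (tY))` — the printed "probabilistic measure" IS
  Mathlib's `Measure.tilted`; with `B14.InterpolationMeasure.integral_gibbsLaw` both descriptions of (3.27) agree.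
* `integrableExpSet_linear_eq_univ`, **`analyticAt_log_partFn_linear`**, `contDiff_log_partFn_linear`: `t ↦ log Z_t` is
  real-analytic on `ℝ` (Mathlib `analyticAt_cgf`), in particular `C^n` for every `n` — so every `t`-derivative used in
  §3 of the paper exists; `deriv_log_partFn_linear`: its first derivative is `⟨Y⟩_t` in Mathlib's closed form
  (`deriv_cgf`), consistent with `B14.InterpolationMeasure.GibbsFamily.hasDerivAt_log_partFn`.
NOT HERE: Bałaban's densities themselves.  No `sorry`, no axiom beyond the standard three.  Companion in the BIJ directory:
`BIJ88Perturbative341` (same seat) — the order-`n̄` Taylor expansion of such a `log Z_t` ([BalabanImbrieJaffe1988] (3.41)).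
-/

noncomputable section

open _root_.MeasureTheory _root_.Set _root_.Filter _root_.ProbabilityTheory
open scoped Topology ENNReal BigOperators

namespace Literature.MathematicalPhysics.QuantumFieldTheory.Balaban1983to89.B14.InterpolationMgf

open B14.InterpolationMeasure

variable {Ω : Type*} [MeasurableSpace Ω] {ν : Measure Ω} {w Y : Ω → ℝ} {K : ℝ}

/-- The reference measure `w·ν` of (3.27) — `dμ_{C^{(k)}(Λ_{k+1})}(A)` times the un-parametrised density
`χ_k exp[−⟨A,C*Δ^{(k)}CA_k⟩ + 𝐏^{(k)} + …]`, as a measure (Mathlib `withDensity`). [cite: Balaban1988Convergent, (3.27) p.271] -/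
def refMeasure (ν : Measure Ω) (w : Ω → ℝ) : Measure Ω := ν.withDensity fun ω => ENNReal.ofReal (w ω)

/-- The reference measure is finite when the weight is integrable. [cite: Balaban1988Convergent, (3.27) p.271] -/
theorem isFiniteMeasure_refMeasure (hw : Integrable w ν) : IsFiniteMeasure (refMeasure ν w) :=
  isFiniteMeasure_withDensity_ofReal hw.2

/-- The reference measure is absolutely continuous with respect to `ν`. [cite: Balaban1988Convergent, (3.27) p.271] -/
theorem refMeasure_absolutelyContinuous (ν : Measure Ω) (w : Ω → ℝ) : refMeasure ν w ≪ ν :=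
  withDensity_absolutelyContinuous _ _

/-- Integration against `w·ν`: `∫ G d(w·ν) = ∫ w G dν` (for `w ≥ 0` a.e., a.e.-measurable).
[cite: Balaban1988Convergent, (3.27) p.271] -/
theorem integral_refMeasure (hw : AEStronglyMeasurable w ν) (hw0 : 0 ≤ᵐ[ν] w) (G : Ω → ℝ) :
    ∫ ω, G ω ∂(refMeasure ν w) = ∫ ω, w ω * G ω ∂ν := by
  rw [refMeasure, integral_withDensity_eq_integral_toReal_smul₀
    (show AEMeasurable (fun ω => ENNReal.ofReal (w ω)) ν from
      ENNReal.measurable_ofReal.comp_aemeasurable hw.aemeasurable) (ae_of_all _ fun _ => ENNReal.ofReal_lt_top)]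
  refine integral_congr_ae ?_
  filter_upwards [hw0] with ω hω
  rw [ENNReal.toReal_ofReal hω, smul_eq_mul]

/-- **`Z_t` IS A MOMENT GENERATING FUNCTION**: for the linear interpolation `S_t = tY`,
`Z_t = ∫ w e^{tY} dν = mgf Y (w·ν) t`. [cite: Balaban1988Convergent, (3.27) p.271] -/
theorem partFn_linear_eq_mgf (hw : AEStronglyMeasurable w ν) (hw0 : 0 ≤ᵐ[ν] w) (Y : Ω → ℝ) (t : ℝ) :
    partFn ν w (fun t ω => t * Y ω) t = mgf Y (refMeasure ν w) t := by
  rw [mgf, integral_refMeasure hw hw0]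
  rfl

/-- … and `log Z_t` is the cumulant generating function `cgf Y (w·ν) t`. [cite: Balaban1988Convergent, (3.27) p.271] -/
theorem log_partFn_linear_eq_cgf (hw : AEStronglyMeasurable w ν) (hw0 : 0 ≤ᵐ[ν] w) (Y : Ω → ℝ) (t : ℝ) :
    Real.log (partFn ν w (fun t ω => t * Y ω) t) = cgf Y (refMeasure ν w) t := by
  rw [cgf, partFn_linear_eq_mgf hw hw0]

/-- **`⟨·⟩_t` IS THE INTEGRAL AGAINST MATHLIB'S TILTED MEASURE**: `⟨G⟩_t = ∫ G d((w·ν).tilted (tY))` — the printed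
*"expectation value with respect to the probabilistic measure Z_{s,t}^{−1} dμ χ_k exp[… + t(…)]"*.
[cite: Balaban1988Convergent, (3.27) p.271] -/
theorem gibbsExpect_linear_eq_integral_tilted (hw : AEStronglyMeasurable w ν) (hw0 : 0 ≤ᵐ[ν] w) (Y G : Ω → ℝ)
    (t : ℝ) :
    gibbsExpect ν w (fun t ω => t * Y ω) G t = ∫ ω, G ω ∂((refMeasure ν w).tilted fun ω => t * Y ω) := by
  rw [integral_tilted, gibbsExpect, gibbsNum, ← mgf, ← partFn_linear_eq_mgf hw hw0, integral_refMeasure hw hw0]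
  rw [div_eq_mul_inv, ← integral_mul_const]
  refine integral_congr_ae (ae_of_all _ fun ω => ?_)
  simp only [gibbsWeight, smul_eq_mul]
  ring

/-- For a bounded `Y` (a.e. `ν`) and an integrable weight, `e^{tY}` is `(w·ν)`-integrable for EVERY real `t`:
`integrableExpSet Y (w·ν) = univ`. [cite: Balaban1988Convergent, (3.27) p.271] -/
theorem integrableExpSet_linear_eq_univ (hw : Integrable w ν) (hY : AEStronglyMeasurable Y ν)
    (hYb : ∀ᵐ ω ∂ν, |Y ω| ≤ K) : integrableExpSet Y (refMeasure ν w) = univ := by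
  haveI := isFiniteMeasure_refMeasure hw
  refine eq_univ_of_forall fun t => ?_
  change Integrable (fun ω => Real.exp (t * Y ω)) (refMeasure ν w)
  have hac := refMeasure_absolutelyContinuous ν w
  refine Integrable.mono' (integrable_const (Real.exp (|t| * K)))
    (Real.continuous_exp.comp_aestronglyMeasurable ((hY.mono_ac hac).const_mul t)) ?_
  filter_upwards [hac.ae_le hYb] with ω hω
  rw [Real.norm_eq_abs, abs_of_nonneg (Real.exp_nonneg _), Real.exp_le_exp]
  calc t * Y ω ≤ |t * Y ω| := le_abs_self _
    _ = |t| * |Y ω| := abs_mul t (Y ω)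
    _ ≤ |t| * K := mul_le_mul_of_nonneg_left hω (abs_nonneg t)

/-- **`log Z_t` IS REAL-ANALYTIC IN THE PARAMETER** (Mathlib `analyticAt_cgf`): all the `t`-derivatives used in §3 of the
paper exist. [cite: Balaban1988Convergent, (3.27) p.271] -/
theorem analyticAt_log_partFn_linear (hw : Integrable w ν) (hw0 : 0 ≤ᵐ[ν] w) (hY : AEStronglyMeasurable Y ν)
    (hYb : ∀ᵐ ω ∂ν, |Y ω| ≤ K) (t₀ : ℝ) :
    AnalyticAt ℝ (fun t => Real.log (partFn ν w (fun t ω => t * Y ω) t)) t₀ := by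
  have h : (fun t => Real.log (partFn ν w (fun t ω => t * Y ω) t)) = cgf Y (refMeasure ν w) :=
    funext fun t => log_partFn_linear_eq_cgf hw.aestronglyMeasurable hw0 Y t
  rw [h]
  refine analyticAt_cgf ?_
  rw [integrableExpSet_linear_eq_univ hw hY hYb, interior_univ]; exact mem_univ t₀

/-- … in particular `C^n` for every `n`. [cite: Balaban1988Convergent, (3.27) p.271] -/
theorem contDiff_log_partFn_linear (hw : Integrable w ν) (hw0 : 0 ≤ᵐ[ν] w) (hY : AEStronglyMeasurable Y ν)
    (hYb : ∀ᵐ ω ∂ν, |Y ω| ≤ K) (n : ℕ) :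
    ContDiff ℝ n (fun t => Real.log (partFn ν w (fun t ω => t * Y ω) t)) := by
  rw [← contDiffOn_univ]
  have h : AnalyticOnNhd ℝ (fun t => Real.log (partFn ν w (fun t ω => t * Y ω) t)) univ :=
    fun t _ => analyticAt_log_partFn_linear hw hw0 hY hYb t
  exact h.contDiffOn_of_completeSpace

/-- The first derivative in Mathlib's closed form: `(d/dt) log Z_t = ∫ Y e^{tY} d(w·ν) / Z_t = ⟨Y⟩_t` (`deriv_cgf`) —
consistent with `B14.InterpolationMeasure.GibbsFamily.hasDerivAt_log_partFn`. [cite: Balaban1988Convergent, (3.27) p.271] -/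
theorem deriv_log_partFn_linear (hw : Integrable w ν) (hw0 : 0 ≤ᵐ[ν] w) (hY : AEStronglyMeasurable Y ν)
    (hYb : ∀ᵐ ω ∂ν, |Y ω| ≤ K) (t : ℝ) :
    deriv (fun t => Real.log (partFn ν w (fun t ω => t * Y ω) t)) t = gibbsExpect ν w (fun t ω => t * Y ω) Y t := by
  have h : (fun t => Real.log (partFn ν w (fun t ω => t * Y ω) t)) = cgf Y (refMeasure ν w) :=
    funext fun t => log_partFn_linear_eq_cgf hw.aestronglyMeasurable hw0 Y t
  have hmem : t ∈ interior (integrableExpSet Y (refMeasure ν w)) := by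
    rw [integrableExpSet_linear_eq_univ hw hY hYb, interior_univ]; exact mem_univ t
  rw [h, deriv_cgf hmem, gibbsExpect, gibbsNum, ← partFn_linear_eq_mgf hw.aestronglyMeasurable hw0,
    integral_refMeasure hw.aestronglyMeasurable hw0]
  congr 1
  refine integral_congr_ae (ae_of_all _ fun ω => ?_)
  simp only [gibbsWeight]
  ring

end Literature.MathematicalPhysics.QuantumFieldTheory.Balaban1983to89.B14.InterpolationMgf
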